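import Literature.IUT.HodgeArakelov.LabelClassesOfCusps

/-!
# [IUTchII] Def 2.3 (v): the outer isomorphism `Π̂^cor_v/Π̂^±_v ≅ 𝔽_l^{⋊±}` is DETERMINED by the torsor chart and the
# label action

S. Mochizuki, *Inter-universal Teichmüller theory II*, kurims manuscript (Dec. 2020), §2 Def 2.3 (v) p. 69: «the
natural action of `Π_⊇/Π_⊆` on `Π_⊆` preserves this `𝔽^±_l`-torsor structure, hence determines a natural outer
isomorphism `Π_⊇/Π_⊆ ≅ 𝔽_l^{⋊±}`» (`Π_⊆ = Π̂^±_v`, `Π_⊇ = Π̂^cor_v`) [claim: Mochizuki2012, status: disputed]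
(IUTchII §2 Def 2.3 (v), kurims p.69) (D-0012 claim key; nothing printed is asserted here).

PROOF-ONLY file (abc-iut cell, seat abc-iut-w5-d243 gen 3; no `def`, no instance, no named fact), INTERFACE LEVEL —
over EVERY `(S, T, W, C)`: the kernel reading of «hence DETERMINES»: two inhabitants `F F' : FlTorsorStructure C`
(abc-iut-L6-t1, `LabelClassesOfCusps.lean`) with the same chart `LabCusp^±(Π̂^±_v) ≃ 𝔽_l` and the same label action
`conjAct` have the SAME isomorphism `quotIso : Π̂^cor_v/Π̂^±_v ≃* 𝔽_l^{⋊±}` (`quotIso_eq_of_chart_eq_of_conjAct_eq`):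
through the chart `g` acts by `x ↦ ε x + a` with `(a, ε) = quotIso ḡ`, and an affine map of `𝔽_l` (`l = S.l` an odd
prime) determines `(a, ε) ∈ 𝔽_l × {±1}` (`a` = value at `0`; `ε` from the value at `1`, using `−1 ≠ 1` in `𝔽_l`).
Companions: `FlTorsorConjActFaithful.lean` (the action is faithful on `Π̂^cor_v/Π̂^±_v`), `FlTorsorStructureNonVacuity.lean`
(p419621: charts/isos of two arbitrary inhabitants differ by SOME permutation/automorphism — here: by NONE once chart and
action agree).  Nothing here bears on [IUTchIII] Cor. 3.12; typed ≠ proved; no side taken.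
-/

noncomputable section

namespace Literature.IUT.HodgeArakelov

universe u

namespace FlTorsorStructure

open Literature.IUT.HodgeTheaters

variable {S : BadPlaceSetting.{u}} {P : TopGroup.{u}} {T : TemperedCoverings S P} {W : PlusMinusTower T}
  {C : CuspidalInertiaData W}

/-- In `𝔽_l` for the setting's odd prime `l`, `−1 ≠ 1`. [claim: Mochizuki2012, status: disputed] (IUTchII §2 Def 2.3 (v), kurims p.69) -/
private theorem neg_one_ne_one' : (-1 : ZMod S.l) ≠ 1 := by
  intro h
  have h2 : ((2 : ℕ) : ZMod S.l) = 0 := by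
    rw [Nat.cast_ofNat]
    calc (2 : ZMod S.l) = 1 + 1 := one_add_one_eq_two.symm
      _ = -1 + 1 := by rw [h]
      _ = 0 := neg_add_cancel 1
  rw [ZMod.natCast_eq_zero_iff] at h2
  exact S.l_odd (le_antisymm (Nat.le_of_dvd two_pos h2) S.l_prime.two_le)

/-- An element of `𝔽_l ⋊ {±1}` is determined by its affine action `x ↦ ε x + a` on `𝔽_l` (`l = S.l` an odd prime).
[claim: Mochizuki2012, status: disputed] (IUTchII §2 Def 2.3 (v), kurims p.69) -/
theorem flPM_eq_of_affine_eq {x y : FlPM S.l}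
    (h : ∀ z : ZMod S.l, Multiplicative.toAdd x.left + ((x.right : ℤ) : ZMod S.l) * z =
      Multiplicative.toAdd y.left + ((y.right : ℤ) : ZMod S.l) * z) : x = y := by
  have h0 : Multiplicative.toAdd x.left = Multiplicative.toAdd y.left := by simpa using h 0
  have h1 : ((x.right : ℤ) : ZMod S.l) = ((y.right : ℤ) : ZMod S.l) := by simpa [h0] using h 1
  refine SemidirectProduct.ext (Multiplicative.toAdd.injective h0) ?_
  rcases Int.units_eq_one_or x.right with ex | ex <;> rcases Int.units_eq_one_or y.right with ey | ey
  · rw [ex, ey]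
  · exfalso
    rw [ex, ey, Units.val_one, Units.val_neg, Units.val_one, Int.cast_one, Int.cast_neg, Int.cast_one] at h1
    exact neg_one_ne_one' h1.symm
  · exfalso
    rw [ex, ey, Units.val_one, Units.val_neg, Units.val_one, Int.cast_one, Int.cast_neg, Int.cast_one] at h1
    exact neg_one_ne_one' h1
  · rw [ex, ey]

/-- **IUTchII:Def2.3(v)** (kurims p. 69) — «hence DETERMINES a natural outer isomorphism `Π̂^cor_v/Π̂^±_v ≅ 𝔽_l^{⋊±}`»,
kernel reading: two `𝔽^±_l`-torsor structures on `LabCusp^±(Π̂^±_v)` with the same chart and the same label action of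
`Π̂^cor_v` have the same isomorphism `quotIso`. [claim: Mochizuki2012, status: disputed] (IUTchII §2 Def 2.3 (v), kurims p.69) -/
theorem quotIso_eq_of_chart_eq_of_conjAct_eq (F F' : FlTorsorStructure C) (hc : ∀ t, F.chart t = F'.chart t)
    (ha : ∀ g t, F.conjAct g t = F'.conjAct g t) : ∀ q, F.quotIso q = F'.quotIso q := by
  intro q
  obtain ⟨g, rfl⟩ := QuotientGroup.mk_surjective q
  refine flPM_eq_of_affine_eq fun z => ?_
  have e := F.conjAct_chart g (F.chart.symm z)
  have e' := F'.conjAct_chart g (F.chart.symm z)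
  rw [← ha, ← hc, e, Equiv.apply_symm_apply] at e'
  rw [← hc, Equiv.apply_symm_apply] at e'
  exact e'

/-- **IUTchII:Def2.3(v)** (kurims p. 69) — the same, as an equality of isomorphisms.
[claim: Mochizuki2012, status: disputed] (IUTchII §2 Def 2.3 (v), kurims p.69) -/
theorem quotIso_eq_of_chart_eq_of_conjAct_eq' (F F' : FlTorsorStructure C) (hc : F.chart = F'.chart)
    (ha : F.conjAct = F'.conjAct) : F.quotIso = F'.quotIso :=
  MulEquiv.ext (quotIso_eq_of_chart_eq_of_conjAct_eq F F' (fun t => by rw [hc]) (fun g t => by rw [ha]))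

end FlTorsorStructure

end Literature.IUT.HodgeArakelov

end
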